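import Mathlib.NumberTheory.NumberField.AdeleRing
import Mathlib.RingTheory.DedekindDomain.FiniteAdeleRing
import Mathlib.RingTheory.DedekindDomain.Factorization
import Mathlib.Topology.Algebra.RestrictedProduct.Basic
import Mathlib.Topology.Algebra.RestrictedProduct.TopologicalSpace
import Mathlib.LinearAlgebra.Matrix.GeneralLinearGroup.Defs
import Mathlib.NumberTheory.NumberField.Completion.FinitePlace
import Mathlib.Algebra.Group.Submonoid.Units
import Mathlib.Algebra.Group.Pi.Units
import Mathlib.Topology.Instances.Matrix
import Mathlib.Topology.Algebra.Group.Units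
import Mathlib.RingTheory.MvPolynomial.Symmetric.Defs
import Literature.NumberTheory.Automorphic.AdelicGroupData
import Literature.NumberTheory.Automorphic.AutomorphicSpectrum
import Literature.NumberTheory.Automorphic.HeckeAlgebra
import Literature.NumberTheory.GaloisRepresentations.IntegralGaloisAction
import HarnessLib

-- provenance: harness21/H21/H21/Prelude/AutomorphicAxiomatic/GLnAdelicStructure.lean @ 966583b (interim HEAD d8f2665); M5 mechanical rewrite
/-!
# Adelic structure of `GL_n` over a number field (trunk G19 AutomorphicAxiomatic, item C12)

Concrete adelic structure of `GL_n` over a number field `K` on the honest datum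
`AdelicGroupData.gl n K` (`Adelic = GL (Fin n) (AdeleRing (𝓞 K) K)`), used by the cuspidal
spectrum, automorphic `L`-functions and the Langlands statements: level subgroups, adelic Hecke
operators `T_{v,i}` at a finite place, Satake parameters, the local embedding
`GL_n(K_v) ↪ GL_n(𝔸_K)` and local components. Notation: `𝔸_K = K_∞ × 𝔸_K^∞`
(`NumberField.AdeleRing (𝓞 K) K`), `𝔸_K^∞ = Πʳ_v [K_v, 𝒪_v]` (`IsDedekindDomain.FiniteAdeleRing`),
`K_v = v.adicCompletion K`, `𝒪_v = v.adicCompletionIntegers K`, `q_v = v.residueCard` (imported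
from `Literature.Prelude.GalRep.IntegralGaloisAction`, never redefined; review F2c).

## Contents (all definitions real; `sorry` only in the proofs of three classical theorems)

* `valuedCongruenceSubgroup m c ≤ GL_m(F)` for a valued field `F`: `g, g⁻¹` integral and
  `g ≡ 1` up to radius `c` (honest subgroup proof by the ultrametric inequality); `c = 1` gives
  `GL_m(𝒪_F)`. (This is the `Valued` analogue of the accepted `glInt n F` of
  `ReductiveGroupData`, which is stated for `[ValuativeRel F]` and hence cannot be applied to
  `K_v = v.adicCompletion K`: the Mathlib pin has no `ValuativeRel` instance on `adicCompletion`,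
  outline D2. Whoever connects `HasLocalComponentAt` with C7's `IsSatakeParameter`/`glInt` must
  identify the two `GL_n(𝒪_v)`'s.)
* `integralFiniteAdeles K = 𝒪̂_K = ∏_v 𝒪_v ≤ 𝔸_K^∞` (a `Subring`, open:
  `isOpen_integralFiniteAdeles`); `glFiniteIntegralLevel n K = GL_n(𝒪̂_K) ≤ GL_n(𝔸_K^∞)` (units of
  Mathlib's `Subring.matrix` via `Submonoid.units`; open, proved; compact, `sorry`), and the
  **level** `glIntegralLevel n K = K^max = {1} × GL_n(𝒪̂_K) ≤ GL_n(𝔸_K) = GL_n(K_∞ × 𝔸_K^∞)`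
  (finite part in `GL_n(𝒪̂_K)`, archimedean part *trivial*), `isCompact_glIntegralLevel` and
  `isHeckeTriple_glIntegralLevel` (`sorry`), `GLn.ofFinite : GL_n(𝔸_K^∞) →* GL_n(𝔸_K)` with
  `map_sndHom_glIntegralLevel` and `isOpen_map_sndHom_glIntegralLevel` (proved);
  `principalCongruenceLevel n K 𝔫 ≤ glIntegralLevel n K` (`g_v` in the valued congruence subgroup
  of radius `|𝔫|_v = idealRadius K v 𝔫` for all `v`, via Mathlib's `FractionalIdeal.count`),
  `principalCongruenceLevel_top : K(1) = K^max` (proved).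
* `oneAddHom f : A →* B`, `a ↦ 1 + f (a - 1)` for a non-unital ring hom `f` (extension by the
  identity off a direct factor); `finiteAdeleSingleHom`, `adeleSingleHom K v : K_v →ₙ+* 𝔸_K`
  (Mathlib `RestrictedProduct.single`); the **local embedding**
  `GLn.ofLocal n K v : GL (Fin n) K_v →* GL (Fin n) 𝔸_K` (real monoid hom, no fallback needed)
  with `GLn.toLocal_ofLocal`, `GLn.toLocal_ofLocal_of_ne`, `GLn.ofLocal_injective`;
  `IsMaximalAt n K v Kf`, `isMaximalAt_glIntegralLevel` and
  `isMaximalAt_principalCongruenceLevel` (`v ∤ 𝔫`; both proved).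
* `uniformizerIdele K v : K_vˣ →* (𝔸_K^∞)ˣ` (Mathlib `RestrictedProduct.mulSingle`), `glDiagonal`,
  the Hecke elements `heckeDiagAt n K v ϖ i = diag(ϖ,…,ϖ,1,…,1)` (`i` copies of `ϖ` at `v`,
  identity elsewhere), `heckeTAt W v ϖ i = [K^max t_{v,i} K^max]` on a closed subrepresentation
  `W ≤ L²(GL_n(𝔸_K) ⧸ A_G GL_n(K))` (`heckeOperatorAt` of `AutomorphicSpectrum`);
  `HasSatakeParameterAt W Kf v ϖ α` (`α : Multiset ℂ`, `card α = n`, `ϖ` a uniformizer, and a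
  non-zero `Kf`-fixed `f` with `T_{v,i} f = q_v^{i(n-i)/2} e_i(α) f`, `e_i = Multiset.esymm`;
  no dependency on `SatakeParametersGL`, review F10), `IsUnramifiedAt W v`,
  `HasLocalComponentAt W v ρ`.

## Design notes

* Outline D10: the automorphic quotient is `GL_n(𝔸_K) ⧸ (A_G · GL_n(K))` with `A_G = ℝ_{>0}`,
  so the full group `GL_n(𝔸_K)` — in particular every `heckeDiagAt` — acts through
  `rightRegular`; this is why D10 chose `A_G` over `GL_n(𝔸)¹`.
* **The level has trivial archimedean component** (review of attempt 1, item 1). The level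
  subgroup `Kf` enters only through `fixedVectors W Kf` (literal `Kf`-invariants) and the
  double-coset Hecke operators. With the open group `GL_n(K_∞) × GL_n(𝒪̂_K)` as level, a fixed
  vector in `L²(GL_n(𝔸_K) ⧸ A_G GL_n(K))` would be `GL_n(K_∞)`-invariant, hence (strong
  approximation for `SL_n`, `n ≥ 2`) factor through `det`, so no cuspidal `W` would have a Satake
  parameter anywhere. Hence `glIntegralLevel n K = {1} × GL_n(𝒪̂_K)` (compact, not open:
  `GL_n(𝔸_K)` has no compact open subgroups at all). Consequently the outline's
  `isOpen_glIntegralLevel` is *replaced* by `isOpen_glFiniteIntegralLevel` (openness lives in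
  `GL_n(𝔸_K^∞)`) together with `isOpen_map_sndHom_glIntegralLevel` (the projection of the level to
  `GL_n(𝔸_K^∞)` is open) and `isCompact_glIntegralLevel`.
* **`IsUnramifiedAt`** (review item 2, flagged for the architect). The outline text
  `IsUnramifiedAt W v := ∃ ϖ α, HasSatakeParameterAt W (glIntegralLevel n K) v ϖ α` says
  "unramified at *every* finite place" (the fixed vector is `K^max`-fixed), so it would fail at all
  `v` for any `W` ramified somewhere, making C13's `exists_hasSatakeParameterAt_cofinite` false and
  C16's `StandardLFunctionData` empty for ramified `Π`. We therefore define
  `IsUnramifiedAt W v := ∃ 𝔫 ≠ 0, v ∤ 𝔫 ∧ ∃ ϖ α, HasSatakeParameterAt W (K(𝔫)) v ϖ α` with the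
  principal congruence subgroup `K(𝔫) = principalCongruenceLevel n K 𝔫`, which is maximal at
  `v ∤ 𝔫` (`isMaximalAt_principalCongruenceLevel`) so that its `t_{v,i}` double cosets are the
  spherical ones; the outline's version implies ours (`IsUnramifiedAt.of_glIntegralLevel`, proved
  via `principalCongruenceLevel_top`). C16's field
  `isSatake : ∀ v ∉ S, ∃ ϖ, HasSatakeParameterAt Π.1 (glIntegralLevel n K) v ϖ (α v)` has the same
  "everywhere unramified" defect and should use `principalCongruenceLevel n K 𝔫` for a conductor
  `𝔫` supported on `S` (architect's call; recorded in SUBMIT notes).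
* Hecke convention: `heckeOperator ρ Kf t = ∑_{y Kf ⊆ Kf t Kf} ρ(y)` with
  `t_{v,i} = diag(ϖ_v,…,ϖ_v,1,…,1)` and `(rightRegular g f)(x) = f (g⁻¹ • x)`; the Satake
  normalisation `q_v^{i(n-i)/2} e_i(α)` is Tamagawa's (Bump §4.6 for `n = 2`;
  Gross, *On the Satake isomorphism*, (3.14)).
* `principalCongruenceLevel`: junk value `K^max` for `𝔫 = 0` (`FractionalIdeal.count 0 = 0`);
  `IsUnramifiedAt` excludes `𝔫 = 0` explicitly.
* Unipotent radicals live in `GLnCuspidalSpectrum` (review F10).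
* Namespaces (review F2): everything in `Literature.Automorphic` (with `AdelicGroupData.gl_toLocal`,
  `AdelicGroupData.coe_map_adeleEval_apply` next to `AdelicGroupData.gl`), except the deliberate
  dot-notation extension `NonUnitalRingHom.mapMatrix` (Mathlib has `RingHom.mapMatrix`,
  `AddMonoidHom.mapMatrix`, … but no non-unital version).

## Mathlib

Used (verified by grep): `IsDedekindDomain.FiniteAdeleRing` and its `DFunLike` coercion,
`RestrictedProduct.single/mulSingle/structureMap/range_structureMap/isOpen_forall_mem`,
`Valued.isOpen_valuationSubring`, `HeightOneSpectrum.mem_adicCompletionIntegers`,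
`Subring.matrix`, `IsOpen.matrix`, `Submonoid.units`, `Submonoid.isOpen_units`,
`Matrix.GeneralLinearGroup.map/ext`, `Matrix.diagonalRingHom`,
`MulEquiv.piUnits`, `NonUnitalRingHom.prod`, `Matrix.map_mul`, `FractionalIdeal.count/count_coe`,
`Associates.count_ne_zero_iff_dvd`, `WithZero.exp`, `Valuation.map_sum_le`, `Multiset.esymm`,
`MonoidHom.inr`. Mathlib has no integral
adeles subring, no `GL_n(𝒪̂)` level, no `GeneralLinearGroup.diagonal`, no local-to-adelic embedding
of `GL_n` and no Satake parameters (all checked by grep).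

## References

* R. Godement, H. Jacquet, *Zeta functions of simple algebras*, LNM 260 (1972), §10.
* D. Bump, *Automorphic forms and representations* (1997), §3.3–3.4, §4.6.
* A. Borel, H. Jacquet, *Automorphic forms and automorphic representations*, Corvallis (1979),
  part 1, §4.6.
* C. Bushnell, G. Henniart, *The local Langlands conjecture for GL(2)* (2006), §7.1, §12.4.
* J. W. S. Cassels, A. Fröhlich (eds.), *Algebraic Number Theory* (1967), Ch. II §14–16.
* B. Gross, *On the Satake isomorphism*, in *Galois representations in arithmetic algebraic
  geometry* (1998), §3.
* G. Shimura, *Introduction to the arithmetic theory of automorphic functions* (1971), Ch. 3.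
* V. Platonov, A. Rapinchuk, *Algebraic groups and number theory* (1994), Ch. 5.
-/

noncomputable section

open scoped MatrixGroups RestrictedProduct
open NumberField IsDedekindDomain MeasureTheory

namespace Literature.NumberTheory.Automorphic

/-! ### Congruence subgroups of `GL_m` over a valued field -/

section Valued

variable {F Γ₀ : Type*} [Field F] [LinearOrderedCommGroupWithZero Γ₀] [Valued F Γ₀]
  (m : Type*) [Fintype m] [DecidableEq m]

omit [DecidableEq m] in
/-- Ultrametric bound for entries of a matrix product: if all entries of `A` have valuation
`≤ a` and all entries of `B` have valuation `≤ b`, then all entries of `A * B` have valuation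
`≤ a * b` (Bushnell–Henniart, *The local Langlands conjecture for GL(2)*, §7.1). [folklore] -/
theorem valued_mul_apply_le {A B : Matrix m m F} {a b : Γ₀}
    (hA : ∀ i j, Valued.v (A i j) ≤ a) (hB : ∀ i j, Valued.v (B i j) ≤ b) (i j : m) :
    Valued.v ((A * B) i j) ≤ a * b := by
  rw [Matrix.mul_apply]
  refine Valued.v.map_sum_le fun k _ => ?_
  rw [map_mul]
  exact mul_le_mul' (hA i k) (hB k j)

/-- The **valued congruence subgroup** of `GL_m(F)` of "radius" `c : Γ₀` for a valued field
`(F, v)`: the invertible matrices `g` with `g` and `g⁻¹` integral (all entries of valuation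
`≤ 1`) and `g ≡ 1 (mod {x | v x ≤ c})`, i.e. every entry of `g - 1` has valuation `≤ c`.
For `c = 1` this is `GL_m(𝒪_F)`; for `F = K_v` and `c = |ϖ_v|^e` it is the principal congruence
subgroup `1 + ϖ_v^e M_m(𝒪_v)` of level `𝔭_v^e` (honest subgroup proofs via the ultrametric
inequality; Bushnell–Henniart §7.1, §12.4; Godement–Jacquet, LNM 260, §10).
`valuedCongruenceSubgroup m 1` is the `Valued` analogue of `Literature.glInt n F`
(`ReductiveGroupData`, for `[ValuativeRel F]`), which does not apply to `v.adicCompletion K`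
since the Mathlib pin has no `ValuativeRel` instance there (outline D2); the two `GL_m(𝒪_F)`'s
agree whenever both make sense but must be identified by whoever links C7 and C12. [folklore] -/
def valuedCongruenceSubgroup (c : Γ₀) : Subgroup (GL m F) where
  carrier := {g | (∀ i j, Valued.v ((g : Matrix m m F) i j) ≤ 1) ∧
    (∀ i j, Valued.v (((g⁻¹ : GL m F) : Matrix m m F) i j) ≤ 1) ∧
    ∀ i j, Valued.v (((g : Matrix m m F) - 1) i j) ≤ c}
  one_mem' := by
    refine ⟨fun i j => ?_, fun i j => ?_, fun i j => ?_⟩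
    · rw [Units.val_one, Matrix.one_apply]
      split_ifs <;> simp
    · rw [inv_one, Units.val_one, Matrix.one_apply]
      split_ifs <;> simp
    · simp
  mul_mem' := by
    rintro g h ⟨hg₁, hg₂, hg₃⟩ ⟨hh₁, hh₂, hh₃⟩
    refine ⟨fun i j => ?_, fun i j => ?_, fun i j => ?_⟩
    · simpa using valued_mul_apply_le m hg₁ hh₁ i j
    · rw [mul_inv_rev]
      simpa using valued_mul_apply_le m hh₂ hg₂ i j
    · have hgh : ((g * h : GL m F) : Matrix m m F) - 1 =
          ((g : Matrix m m F) - 1) * (h : Matrix m m F) + ((h : Matrix m m F) - 1) := by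
        rw [Units.val_mul, sub_mul, one_mul, sub_add_sub_cancel]
      rw [hgh, Matrix.add_apply]
      refine Valued.v.map_add_le ?_ (hh₃ i j)
      simpa using valued_mul_apply_le m hg₃ hh₁ i j
  inv_mem' := by
    rintro g ⟨hg₁, hg₂, hg₃⟩
    refine ⟨hg₂, fun i j => by simpa using hg₁ i j, fun i j => ?_⟩
    have hg : ((g⁻¹ : GL m F) : Matrix m m F) - 1 =
        -(((g⁻¹ : GL m F) : Matrix m m F) * ((g : Matrix m m F) - 1)) := by
      rw [mul_sub, mul_one, Units.inv_mul, neg_sub]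
    rw [hg, Matrix.neg_apply, Valuation.map_neg]
    simpa using valued_mul_apply_le m hg₂ hg₃ i j

variable {m} in
/-- Membership in the valued congruence subgroup (definitional unfolding). [folklore] -/
theorem mem_valuedCongruenceSubgroup_iff {c : Γ₀} {g : GL m F} :
    g ∈ valuedCongruenceSubgroup m c ↔
      (∀ i j, Valued.v ((g : Matrix m m F) i j) ≤ 1) ∧
        (∀ i j, Valued.v (((g⁻¹ : GL m F) : Matrix m m F) i j) ≤ 1) ∧
        ∀ i j, Valued.v (((g : Matrix m m F) - 1) i j) ≤ c :=
  Iff.rfl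

/-- The valued congruence subgroups decrease with the radius (Bushnell–Henniart §12.4). [folklore] -/
theorem valuedCongruenceSubgroup_mono {c c' : Γ₀} (h : c ≤ c') :
    valuedCongruenceSubgroup (F := F) m c ≤ valuedCongruenceSubgroup m c' :=
  fun _ ⟨h₁, h₂, h₃⟩ => ⟨h₁, h₂, fun i j => (h₃ i j).trans h⟩

end Valued

/-! ### A monoid homomorphism from a non-unital ring homomorphism -/

section OneAdd

variable {A B : Type*} [Ring A] [Ring B]

/-- For a non-unital ring homomorphism `f : A →ₙ+* B` between (unital) rings — typically the
inclusion of a direct factor, `f 1 = e` an idempotent — the map `a ↦ 1 + f (a - 1) = f a + (1 - e)`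
is a monoid homomorphism `A →* B` ("extend by the identity off the factor"). Used to embed
`GL_n(K_v) ↪ GL_n(𝔸_K)` (Godement–Jacquet, LNM 260, §10; Bump, *Automorphic forms and
representations*, §3.3). [folklore] -/
def oneAddHom (f : A →ₙ+* B) : A →* B where
  toFun a := 1 + f (a - 1)
  map_one' := by simp
  map_mul' a b := by
    have hab : a * b - 1 = (a - 1) * (b - 1) + (a - 1) + (b - 1) := by noncomm_ring
    rw [hab, map_add, map_add, map_mul]
    noncomm_ring

/-- `oneAddHom f a = 1 + f (a - 1)` (definitional). [folklore] -/
@[simp]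
theorem oneAddHom_apply (f : A →ₙ+* B) (a : A) : oneAddHom f a = 1 + f (a - 1) := rfl

end OneAdd

/-! ### Integral adeles and the level subgroups of `GL_n(𝔸_K)` -/

section Level

variable (n : ℕ) (K : Type) [Field K] [NumberField K]

/-- The **integral finite adeles** `𝒪̂_K = ∏_v 𝒪_v ≤ 𝔸_K^∞`: the finite adeles which are
integral at every finite place (Mathlib has `FiniteAdeleRing (𝓞 K) K = Πʳ_v [K_v, 𝒪_v]` with its
`DFunLike` coercion to `K_v`, and `RestrictedProduct.structureMap` whose range this is
(`coe_integralFiniteAdeles_eq_range_structureMap`), but no name for the subring; Cassels–Fröhlich,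
Ch. II §14; Godement–Jacquet, LNM 260, §10). [folklore] -/
def integralFiniteAdeles : Subring (FiniteAdeleRing (𝓞 K) K) where
  carrier := {x | ∀ v, x v ∈ v.adicCompletionIntegers K}
  mul_mem' hx hy v := mul_mem (hx v) (hy v)
  one_mem' _ := one_mem _
  add_mem' hx hy v := add_mem (hx v) (hy v)
  zero_mem' _ := zero_mem _
  neg_mem' hx v := neg_mem (hx v)

variable {K} in
/-- Membership in `𝒪̂_K`: integrality at every finite place (definitional). [folklore] -/
@[simp]
theorem mem_integralFiniteAdeles_iff {x : FiniteAdeleRing (𝓞 K) K} :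
    x ∈ integralFiniteAdeles K ↔ ∀ v, x v ∈ v.adicCompletionIntegers K :=
  Iff.rfl

/-- `𝒪̂_K` is the range of Mathlib's structure map `∏_v 𝒪_v → Πʳ_v [K_v, 𝒪_v]`
(`RestrictedProduct.range_structureMap`). [folklore] -/
theorem coe_integralFiniteAdeles_eq_range_structureMap :
    (integralFiniteAdeles K : Set (FiniteAdeleRing (𝓞 K) K)) =
      Set.range (RestrictedProduct.structureMap
        (fun v : HeightOneSpectrum (𝓞 K) => v.adicCompletion K)
        (fun v : HeightOneSpectrum (𝓞 K) => (v.adicCompletionIntegers K : Set (v.adicCompletion K)))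
        Filter.cofinite) := by
  rw [RestrictedProduct.range_structureMap]
  rfl

/-- `𝒪̂_K` is open in `𝔸_K^∞` (each `𝒪_v` is open in `K_v`; Mathlib
`RestrictedProduct.isOpen_forall_mem`, `Valued.isOpen_valuationSubring`; Cassels–Fröhlich,
Ch. II §14). [folklore] -/
theorem isOpen_integralFiniteAdeles :
    IsOpen (integralFiniteAdeles K : Set (FiniteAdeleRing (𝓞 K) K)) :=
  RestrictedProduct.isOpen_forall_mem
    (R := fun v : HeightOneSpectrum (𝓞 K) => v.adicCompletion K)
    (A := fun v : HeightOneSpectrum (𝓞 K) =>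
      (v.adicCompletionIntegers K : Set (v.adicCompletion K)))
    fun _ => Valued.isOpen_valuationSubring _

/-- The compact open subgroup `GL_n(𝒪̂_K) = ∏_v GL_n(𝒪_v) ≤ GL_n(𝔸_K^∞)`: invertible finite-adelic
matrices `g` with `g` and `g⁻¹` having entries in `𝒪̂_K` (Mathlib `Subring.matrix`,
`Submonoid.units`; Godement–Jacquet, LNM 260, §10; Bump, *Automorphic forms and representations*,
§3.3). [folklore] -/
def glFiniteIntegralLevel : Subgroup (GL (Fin n) (FiniteAdeleRing (𝓞 K) K)) :=
  ((integralFiniteAdeles K).matrix : Subring (Matrix (Fin n) (Fin n) _)).toSubmonoid.units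

variable {n K} in
/-- Membership in `GL_n(𝒪̂_K)`: all entries of `g` and `g⁻¹` are integral. [folklore] -/
theorem mem_glFiniteIntegralLevel_iff {g : GL (Fin n) (FiniteAdeleRing (𝓞 K) K)} :
    g ∈ glFiniteIntegralLevel n K ↔
      (∀ i j, (g : Matrix (Fin n) (Fin n) (FiniteAdeleRing (𝓞 K) K)) i j ∈
          integralFiniteAdeles K) ∧
        ∀ i j, ((g⁻¹ : GL (Fin n) (FiniteAdeleRing (𝓞 K) K)) :
          Matrix (Fin n) (Fin n) (FiniteAdeleRing (𝓞 K) K)) i j ∈ integralFiniteAdeles K :=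
  Iff.rfl

/-- `GL_n(𝒪̂_K)` is open in `GL_n(𝔸_K^∞)` (`𝒪̂_K` is open in `𝔸_K^∞`, matrices with entries in
an open set are open, and units of an open submonoid are open, Mathlib `Submonoid.isOpen_units`;
Godement–Jacquet, LNM 260, §10). This is where the openness of the outline's
`isOpen_glIntegralLevel` lives: see the module docstring and `isOpen_map_sndHom_glIntegralLevel`. [folklore] -/
theorem isOpen_glFiniteIntegralLevel :
    IsOpen (glFiniteIntegralLevel n K : Set (GL (Fin n) (FiniteAdeleRing (𝓞 K) K))) :=
  Submonoid.isOpen_units (isOpen_integralFiniteAdeles K).matrix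

/-- `GL_n(𝒪̂_K) = ∏_v GL_n(𝒪_v)` is compact (Tychonoff; each `GL_n(𝒪_v)` is compact as `𝒪_v` is;
Godement–Jacquet, LNM 260, §10; Platonov–Rapinchuk, *Algebraic groups and number theory*,
Ch. 5). [cite: PlatonovRapinchuk1994, Ch. 5 (§5.1: adelic points of GL_n; compactness of GL_n(𝒪̂))] [cite: GodementJacquetLNM260, §10] -/
def isCompact_glFiniteIntegralLevel : Prop :=
  IsCompact (glFiniteIntegralLevel n K : Set (GL (Fin n) (FiniteAdeleRing (𝓞 K) K)))

/-- The projection `GL_n(𝔸_K) →* GL_n(𝔸_K^∞)` onto the finite part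
(`GeneralLinearGroup.map` of `RingHom.snd`). [folklore] -/
abbrev GLn.sndHom : GL (Fin n) (AdeleRing (𝓞 K) K) →* GL (Fin n) (FiniteAdeleRing (𝓞 K) K) :=
  Matrix.GeneralLinearGroup.map (RingHom.snd (InfiniteAdeleRing K) (FiniteAdeleRing (𝓞 K) K))

/-- The projection `GL_n(𝔸_K) →* GL_n(K_∞)` onto the archimedean part
(`GeneralLinearGroup.map` of `RingHom.fst`). [folklore] -/
abbrev GLn.fstHom : GL (Fin n) (AdeleRing (𝓞 K) K) →* GL (Fin n) (InfiniteAdeleRing K) :=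
  Matrix.GeneralLinearGroup.map (RingHom.fst (InfiniteAdeleRing K) (FiniteAdeleRing (𝓞 K) K))

/-- The **integral level** `K^max = {1} × GL_n(𝒪̂_K) ≤ GL_n(𝔸_K) = GL_n(K_∞ × 𝔸_K^∞)`: invertible
adelic matrices whose finite part lies in `GL_n(𝒪̂_K)` and whose archimedean part is the identity
(compact, not open). This is the level whose fixed vectors and double-coset Hecke operators
define Satake parameters; the archimedean component must be trivial, since a
`GL_n(K_∞)`-invariant `L²`-function on `GL_n(𝔸_K) ⧸ A_G GL_n(K)` factors through `det` (see the
module docstring). (Godement–Jacquet, LNM 260, §10; Bump §3.3; Borel–Jacquet (1979), §4.6.) [cite: BorelJacquet1979] -/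
def glIntegralLevel : Subgroup (GL (Fin n) (AdeleRing (𝓞 K) K)) :=
  (glFiniteIntegralLevel n K).comap (GLn.sndHom n K) ⊓ (GLn.fstHom n K).ker

variable {n K} in
/-- Membership in the integral level: the finite part of `g` lies in `GL_n(𝒪̂_K)` and the
archimedean part is `1` (Godement–Jacquet, LNM 260, §10). [folklore] -/
theorem mem_glIntegralLevel_iff {g : GL (Fin n) (AdeleRing (𝓞 K) K)} :
    g ∈ glIntegralLevel n K ↔
      GLn.sndHom n K g ∈ glFiniteIntegralLevel n K ∧ GLn.fstHom n K g = 1 :=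
  Iff.rfl

variable {n K} in
/-- Membership in the integral level, entrywise: the finite parts of all entries of `g` and
`g⁻¹` are integral and the archimedean parts of the entries of `g` are those of the identity
matrix. [folklore] -/
theorem mem_glIntegralLevel_iff' {g : GL (Fin n) (AdeleRing (𝓞 K) K)} :
    g ∈ glIntegralLevel n K ↔
      ((∀ i j, ((g : Matrix (Fin n) (Fin n) (AdeleRing (𝓞 K) K)) i j).2 ∈ integralFiniteAdeles K) ∧
        ∀ i j, (((g⁻¹ : GL (Fin n) (AdeleRing (𝓞 K) K)) :
          Matrix (Fin n) (Fin n) (AdeleRing (𝓞 K) K)) i j).2 ∈ integralFiniteAdeles K) ∧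
      ∀ i j, ((g : Matrix (Fin n) (Fin n) (AdeleRing (𝓞 K) K)) i j).1 =
        (1 : Matrix (Fin n) (Fin n) (InfiniteAdeleRing K)) i j := by
  rw [mem_glIntegralLevel_iff, mem_glFiniteIntegralLevel_iff, ← map_inv]
  refine and_congr Iff.rfl ⟨fun h i j => ?_, fun h => Matrix.GeneralLinearGroup.ext h⟩
  exact congrFun (congrFun (congrArg (fun u : GL (Fin n) (InfiniteAdeleRing K) =>
    (u : Matrix (Fin n) (Fin n) (InfiniteAdeleRing K))) h) i) j

/-- The integral level `K^max = {1} × GL_n(𝒪̂_K)` is compact (it is the homeomorphic image of the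
compact group `GL_n(𝒪̂_K)`, `isCompact_glFiniteIntegralLevel`; Godement–Jacquet, LNM 260, §10;
Platonov–Rapinchuk, Ch. 5). Needed by the Hecke-eigenvector theorems of C11. [cite: PlatonovRapinchuk1994, Ch. 5 (§5.1)] -/
def isCompact_glIntegralLevel : Prop :=
  IsCompact (glIntegralLevel n K : Set (GL (Fin n) (AdeleRing (𝓞 K) K)))

/-- The integral level is a Hecke pair with `GL_n(𝔸_K)`: every double coset `K^max g K^max` is a
finite union of left cosets, since `K^max ∩ g K^max g⁻¹ = {1} × (GL_n(𝒪̂_K) ∩ g_f GL_n(𝒪̂_K) g_f⁻¹)`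
is open, hence of finite index, in the compact group `K^max ≅ GL_n(𝒪̂_K)`
(Godement–Jacquet, LNM 260, §10; Shimura, *Introduction to the arithmetic theory of automorphic
functions*, Ch. 3). [cite: ShimuraIATAF1971, Ch. 3 (§3.1: commensurability and Hecke rings)] [cite: GodementJacquetLNM260, §10] -/
def isHeckeTriple_glIntegralLevel : Prop :=
  IsHeckeTriple (⊤ : Submonoid (GL (Fin n) (AdeleRing (𝓞 K) K))) (glIntegralLevel n K)
      (glIntegralLevel n K)

/-! ### Principal congruence subgroups -/

/-- The radius `|𝔫|_v = exp (-ord_v 𝔫) ∈ ℤᵐ⁰` of the ideal `𝔫 ⊆ 𝓞 K` at the finite place `v`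
(Mathlib `FractionalIdeal.count` of `𝔫` as a fractional ideal, which is `ord_v 𝔫` by
`FractionalIdeal.count_coe`; junk value `1` for `𝔫 = 0` since `count 0 = 0`;
Neukirch, *Algebraic Number Theory*, Ch. I §11). [folklore] -/
def idealRadius (v : HeightOneSpectrum (𝓞 K)) (𝔫 : Ideal (𝓞 K)) : WithZero (Multiplicative ℤ) :=
  WithZero.exp (-FractionalIdeal.count K v (𝔫 : FractionalIdeal (nonZeroDivisors (𝓞 K)) K))

/-- `|1|_v = 1` (`FractionalIdeal.count_one`). [folklore] -/
@[simp]
theorem idealRadius_top (v : HeightOneSpectrum (𝓞 K)) : idealRadius K v ⊤ = 1 := by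
  rw [idealRadius, FractionalIdeal.coeIdeal_top, FractionalIdeal.count_one, neg_zero,
    WithZero.exp_zero]

variable {K} in
/-- `|𝔫|_v = 1` for `v ∤ 𝔫`, `𝔫 ≠ 0` (`FractionalIdeal.count_coe`,
`Associates.count_ne_zero_iff_dvd`; Neukirch, Ch. I §11). [folklore] -/
theorem idealRadius_eq_one_of_not_dvd {v : HeightOneSpectrum (𝓞 K)} {𝔫 : Ideal (𝓞 K)}
    (h𝔫 : 𝔫 ≠ 0) (hv : ¬ v.asIdeal ∣ 𝔫) : idealRadius K v 𝔫 = 1 := by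
  have h0 : (Associates.mk v.asIdeal).count (Associates.mk 𝔫).factors = 0 := by
    by_contra h
    exact hv ((Associates.count_ne_zero_iff_dvd h𝔫 v.irreducible).mp h)
  rw [idealRadius, FractionalIdeal.count_coe K v h𝔫, h0, Nat.cast_zero, neg_zero, WithZero.exp_zero]

/-- The **principal congruence subgroup** `K(𝔫) ≤ K^max ≤ GL_n(𝔸_K)` of level `𝔫 ⊆ 𝓞 K`: the
`g ∈ K^max` (finite part in `GL_n(𝒪̂_K)`, archimedean part trivial) with `g_v ≡ 1 (mod 𝔫 𝒪_v)`
at every finite place `v`, i.e. `g_v` in the valued congruence subgroup of radius `|𝔫|_v`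
(`valuedCongruenceSubgroup`, pulled back along `GL_n(𝔸_K) → GL_n(K_v)`). For `𝔫 = 0` the junk
value is `K^max` (Godement–Jacquet, LNM 260, §10; Bump §3.3). [folklore] -/
def principalCongruenceLevel (𝔫 : Ideal (𝓞 K)) : Subgroup (GL (Fin n) (AdeleRing (𝓞 K) K)) :=
  glIntegralLevel n K ⊓ ⨅ v : HeightOneSpectrum (𝓞 K),
    (valuedCongruenceSubgroup (Fin n) (idealRadius K v 𝔫)).comap
      (Matrix.GeneralLinearGroup.map (AdelicGroupData.adeleEval K v))

/-- `K(𝔫) ≤ K^max` (Godement–Jacquet, LNM 260, §10). [folklore] -/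
theorem principalCongruenceLevel_le (𝔫 : Ideal (𝓞 K)) :
    principalCongruenceLevel n K 𝔫 ≤ glIntegralLevel n K :=
  inf_le_left

variable {n K} in
/-- Membership in `K(𝔫)`: `g ∈ K^max` and `g_v` lies in the valued congruence subgroup of
radius `|𝔫|_v` for every `v` (here `(gl n K).toLocal v = GeneralLinearGroup.map (adeleEval K v)`
definitionally). [folklore] -/
theorem mem_principalCongruenceLevel_iff {𝔫 : Ideal (𝓞 K)}
    {g : GL (Fin n) (AdeleRing (𝓞 K) K)} :
    g ∈ principalCongruenceLevel n K 𝔫 ↔ g ∈ glIntegralLevel n K ∧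
      ∀ v : HeightOneSpectrum (𝓞 K), (AdelicGroupData.gl n K).toLocal v g ∈
        valuedCongruenceSubgroup (Fin n) (idealRadius K v 𝔫) := by
  simp only [principalCongruenceLevel, Subgroup.mem_inf, Subgroup.mem_iInf, Subgroup.mem_comap]
  rfl

variable {n K} in
/-- For `g ∈ K^max` every local component `g_v` lies in `GL_n(𝒪_v)`, the valued congruence
subgroup of radius `1` (entries of `g_v, g_v⁻¹` are the `v`-components of the finite parts of
the entries of `g, g⁻¹`; Godement–Jacquet, LNM 260, §10). [folklore] -/
theorem toLocal_mem_valuedCongruenceSubgroup_one {g : GL (Fin n) (AdeleRing (𝓞 K) K)}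
    (hg : g ∈ glIntegralLevel n K) (v : HeightOneSpectrum (𝓞 K)) :
    (AdelicGroupData.gl n K).toLocal v g ∈
      valuedCongruenceSubgroup (Fin n) (1 : WithZero (Multiplicative ℤ)) := by
  change Matrix.GeneralLinearGroup.map (AdelicGroupData.adeleEval K v) g ∈ _
  rw [mem_glIntegralLevel_iff'] at hg
  obtain ⟨⟨h₁, h₂⟩, -⟩ := hg
  have h₁' : ∀ i j, Valued.v ((Matrix.GeneralLinearGroup.map (AdelicGroupData.adeleEval K v) g :
      Matrix (Fin n) (Fin n) (v.adicCompletion K)) i j) ≤ 1 := fun i j =>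
    (HeightOneSpectrum.mem_adicCompletionIntegers (R := 𝓞 K) K v).mp (h₁ i j v)
  refine ⟨h₁', fun i j => ?_, fun i j => ?_⟩
  · rw [← map_inv]
    exact (HeightOneSpectrum.mem_adicCompletionIntegers (R := 𝓞 K) K v).mp (h₂ i j v)
  · rw [Matrix.sub_apply]
    refine (Valued.v.map_sub _ _).trans (max_le (h₁' i j) ?_)
    rw [Matrix.one_apply]
    split_ifs <;> simp

/-- `K(1) = K^max`: the principal congruence subgroup of level `𝔫 = 𝓞 K` is the full integral
level (Godement–Jacquet, LNM 260, §10). [folklore] -/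
@[simp]
theorem principalCongruenceLevel_top : principalCongruenceLevel n K ⊤ = glIntegralLevel n K := by
  refine le_antisymm (principalCongruenceLevel_le n K ⊤) fun g hg => ?_
  rw [mem_principalCongruenceLevel_iff]
  refine ⟨hg, fun v => ?_⟩
  rw [idealRadius_top]
  exact toLocal_mem_valuedCongruenceSubgroup_one hg v

end Level

end Literature.NumberTheory.Automorphic

/-! ### `Matrix.map` along a non-unital ring homomorphism (dot-notation extension) -/

namespace NonUnitalRingHom

variable {α β : Type*} [NonUnitalNonAssocSemiring α] [NonUnitalNonAssocSemiring β]
  (m : Type*) [Fintype m]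

/-- The non-unital ring homomorphism `Matrix m m α →ₙ+* Matrix m m β` induced entrywise by a
non-unital ring homomorphism `α →ₙ+* β` (Mathlib has `RingHom.mapMatrix`, `AddMonoidHom.mapMatrix`
etc. but not the non-unital version; multiplicativity is Mathlib's `Matrix.map_mul`).
Deliberate dot-notation extension of Mathlib's `NonUnitalRingHom` namespace. [folklore] -/
def mapMatrix (f : α →ₙ+* β) : Matrix m m α →ₙ+* Matrix m m β :=
  { f.toAddMonoidHom.mapMatrix with
    toFun := fun M => M.map f
    map_mul' := fun _ _ => Matrix.map_mul }

/-- `f.mapMatrix M = M.map f` (definitional). [folklore] -/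
@[simp]
theorem mapMatrix_apply (f : α →ₙ+* β) (M : Matrix m m α) : f.mapMatrix m M = M.map f := rfl

end NonUnitalRingHom

namespace Literature.NumberTheory.Automorphic

/-! ### Local pieces: single-place adeles, the embedding `GL_n(K_v) ↪ GL_n(𝔸_K)` -/

section Local

variable (n : ℕ) (K : Type) [Field K] [NumberField K] (v : HeightOneSpectrum (𝓞 K))

open scoped Classical in
/-- The non-unital ring homomorphism `K_v →ₙ+* 𝔸_K^∞`, `x ↦ (x at v, 0 elsewhere)` (Mathlib
`RestrictedProduct.single`; it is additive and multiplicative but does not preserve `1`;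
Cassels–Fröhlich, Ch. II §14). [folklore] -/
def finiteAdeleSingleHom : v.adicCompletion K →ₙ+* FiniteAdeleRing (𝓞 K) K where
  toFun x := (RestrictedProduct.single
    (fun w : HeightOneSpectrum (𝓞 K) => w.adicCompletionIntegers K) v x :
      Πʳ w : HeightOneSpectrum (𝓞 K), [w.adicCompletion K, w.adicCompletionIntegers K])
  map_zero' := RestrictedProduct.single_zero _ _
  map_add' := RestrictedProduct.single_add _ _
  map_mul' x y := by
    conv_lhs => rw [← RestrictedProduct.single_eq_same
      (fun w : HeightOneSpectrum (𝓞 K) => w.adicCompletionIntegers K) v x]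
    exact RestrictedProduct.mul_single _ v y _

/-- `finiteAdeleSingleHom K v x` has component `x` at `v` (`RestrictedProduct.single_eq_same`). [folklore] -/
@[simp]
theorem finiteAdeleSingleHom_apply_self (x : v.adicCompletion K) :
    finiteAdeleSingleHom K v x v = x := by
  classical
  exact RestrictedProduct.single_eq_same _ v x

/-- `finiteAdeleSingleHom K v x` vanishes away from `v` (`RestrictedProduct.single_eq_of_ne`). [folklore] -/
theorem finiteAdeleSingleHom_apply_of_ne {w : HeightOneSpectrum (𝓞 K)} (x : v.adicCompletion K)
    (h : w ≠ v) : finiteAdeleSingleHom K v x w = 0 := by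
  classical
  exact RestrictedProduct.single_eq_of_ne _ x h

/-- The non-unital ring homomorphism `K_v →ₙ+* 𝔸_K = K_∞ × 𝔸_K^∞`, `x ↦ (0, x at v, 0 elsewhere)`:
the inclusion of the direct factor `K_v` of the adele ring (Cassels–Fröhlich, Ch. II §14). [folklore] -/
def adeleSingleHom : v.adicCompletion K →ₙ+* AdeleRing (𝓞 K) K :=
  (0 : v.adicCompletion K →ₙ+* InfiniteAdeleRing K).prod (finiteAdeleSingleHom K v)

/-- The archimedean component of `adeleSingleHom K v x` is `0`. [folklore] -/
@[simp]
theorem adeleSingleHom_apply_fst (x : v.adicCompletion K) : (adeleSingleHom K v x).1 = 0 := rfl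

/-- The finite component of `adeleSingleHom K v x` is `finiteAdeleSingleHom K v x`. [folklore] -/
@[simp]
theorem adeleSingleHom_apply_snd (x : v.adicCompletion K) :
    (adeleSingleHom K v x).2 = finiteAdeleSingleHom K v x := rfl

/-- `adeleSingleHom` is a section of the projection `adeleEval K v : 𝔸_K → K_v`. [folklore] -/
theorem adeleEval_adeleSingleHom (x : v.adicCompletion K) :
    AdelicGroupData.adeleEval K v (adeleSingleHom K v x) = x :=
  finiteAdeleSingleHom_apply_self K v x

/-- `adeleSingleHom K v x` projects to `0` at every finite place `w ≠ v`. [folklore] -/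
theorem adeleEval_adeleSingleHom_of_ne {w : HeightOneSpectrum (𝓞 K)} (x : v.adicCompletion K)
    (h : w ≠ v) : AdelicGroupData.adeleEval K w (adeleSingleHom K v x) = 0 :=
  finiteAdeleSingleHom_apply_of_ne K v x h

/-- `adeleEval K v` maps the identity matrix entries of `M_n(𝔸_K)` to those of `M_n(K_v)`. [folklore] -/
theorem adeleEval_one_apply (w : HeightOneSpectrum (𝓞 K)) (i j : Fin n) :
    AdelicGroupData.adeleEval K w ((1 : Matrix (Fin n) (Fin n) (AdeleRing (𝓞 K) K)) i j) =
      (1 : Matrix (Fin n) (Fin n) (w.adicCompletion K)) i j := by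
  rw [Matrix.one_apply, Matrix.one_apply]
  split_ifs <;> rfl

/-- **The local embedding** `GL_n(K_v) →* GL_n(𝔸_K)`, `g ↦ (g at v, 1 at every other place)`:
on matrices it is `g ↦ 1 + ι_v (g - 1)` for the factor inclusion `ι_v = adeleSingleHom K v`
applied entrywise, an honest monoid homomorphism (`oneAddHom`), then `Units.map`
(Godement–Jacquet, LNM 260, §10; Bump, *Automorphic forms and representations*, §3.3). [folklore] -/
def GLn.ofLocal : GL (Fin n) (v.adicCompletion K) →* GL (Fin n) (AdeleRing (𝓞 K) K) :=
  Units.map (oneAddHom ((adeleSingleHom K v).mapMatrix (Fin n)))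

variable {n K v} in
/-- Entries of `GLn.ofLocal g`: `δ_{ij} + ι_v (g_{ij} - δ_{ij})` (definitional). [folklore] -/
theorem GLn.coe_ofLocal_apply (g : GL (Fin n) (v.adicCompletion K)) (i j : Fin n) :
    (GLn.ofLocal n K v g : Matrix (Fin n) (Fin n) (AdeleRing (𝓞 K) K)) i j =
      (1 : Matrix (Fin n) (Fin n) (AdeleRing (𝓞 K) K)) i j +
        adeleSingleHom K v ((g : Matrix (Fin n) (Fin n) (v.adicCompletion K)) i j -
          (1 : Matrix (Fin n) (Fin n) (v.adicCompletion K)) i j) :=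
  rfl

/-- `(gl n K).toLocal w` is `GeneralLinearGroup.map (adeleEval K w)` (definitional). [folklore] -/
theorem AdelicGroupData.gl_toLocal (w : HeightOneSpectrum (𝓞 K)) :
    (AdelicGroupData.gl n K).toLocal w =
      Matrix.GeneralLinearGroup.map (n := Fin n) (AdelicGroupData.adeleEval K w) :=
  rfl

variable {n K} in
/-- Entries of `GeneralLinearGroup.map (adeleEval K w) G = (gl n K).toLocal w G` are the
`w`-components of the entries of `G` (definitional). [folklore] -/
theorem AdelicGroupData.coe_map_adeleEval_apply (w : HeightOneSpectrum (𝓞 K))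
    (G : GL (Fin n) (AdeleRing (𝓞 K) K)) (i j : Fin n) :
    (Matrix.GeneralLinearGroup.map (AdelicGroupData.adeleEval K w) G :
        Matrix (Fin n) (Fin n) (w.adicCompletion K)) i j =
      AdelicGroupData.adeleEval K w ((G : Matrix (Fin n) (Fin n) (AdeleRing (𝓞 K) K)) i j) :=
  rfl

variable {n K v} in
/-- The `v`-component of `GLn.ofLocal g` is `g` (Godement–Jacquet, LNM 260, §10). [folklore] -/
theorem GLn.toLocal_ofLocal (g : GL (Fin n) (v.adicCompletion K)) :
    (AdelicGroupData.gl n K).toLocal v (GLn.ofLocal n K v g) = g := by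
  show Matrix.GeneralLinearGroup.map (AdelicGroupData.adeleEval K v) (GLn.ofLocal n K v g) = g
  refine Matrix.GeneralLinearGroup.ext fun i j => ?_
  rw [AdelicGroupData.coe_map_adeleEval_apply, GLn.coe_ofLocal_apply, map_add,
    adeleEval_adeleSingleHom, adeleEval_one_apply, add_sub_cancel]

variable {n K v} in
/-- The `w`-component of `GLn.ofLocal g` is `1` for `w ≠ v` (Godement–Jacquet, LNM 260, §10). [folklore] -/
theorem GLn.toLocal_ofLocal_of_ne {w : HeightOneSpectrum (𝓞 K)} (h : w ≠ v)
    (g : GL (Fin n) (v.adicCompletion K)) :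
    (AdelicGroupData.gl n K).toLocal w (GLn.ofLocal n K v g) = 1 := by
  show Matrix.GeneralLinearGroup.map (AdelicGroupData.adeleEval K w) (GLn.ofLocal n K v g) = 1
  refine Matrix.GeneralLinearGroup.ext fun i j => ?_
  rw [AdelicGroupData.coe_map_adeleEval_apply, GLn.coe_ofLocal_apply, map_add,
    adeleEval_adeleSingleHom_of_ne K v _ h, adeleEval_one_apply, add_zero, Units.val_one]

variable {n K v} in
/-- The archimedean component of `GLn.ofLocal g` is the identity matrix
(Godement–Jacquet, LNM 260, §10). [folklore] -/
theorem GLn.fst_coe_ofLocal_apply (g : GL (Fin n) (v.adicCompletion K)) (i j : Fin n) :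
    ((GLn.ofLocal n K v g : Matrix (Fin n) (Fin n) (AdeleRing (𝓞 K) K)) i j).1 =
      (1 : Matrix (Fin n) (Fin n) (InfiniteAdeleRing K)) i j := by
  rw [GLn.coe_ofLocal_apply]
  change ((1 : Matrix (Fin n) (Fin n) (AdeleRing (𝓞 K) K)) i j).1 + (adeleSingleHom K v _).1 = _
  rw [adeleSingleHom_apply_fst, add_zero, Matrix.one_apply, Matrix.one_apply]
  split_ifs <;> rfl

variable {n K v} in
/-- The local embedding `GL_n(K_v) →* GL_n(𝔸_K)` is injective. [folklore] -/
theorem GLn.ofLocal_injective : Function.Injective (GLn.ofLocal n K v) :=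
  Function.LeftInverse.injective GLn.toLocal_ofLocal

/-- A level subgroup `Kf ≤ GL_n(𝔸_K)` is **maximal at `v`** if it contains the image of
`GL_n(𝒪_v)` (the valued congruence subgroup of radius `1`) under the local embedding
(Bump §3.3; Borel–Jacquet (1979), §4.6: `Kf = ∏_w K_w` with `K_v = GL_n(𝒪_v)`). [cite: BorelJacquet1979] -/
def IsMaximalAt (Kf : Subgroup (GL (Fin n) (AdeleRing (𝓞 K) K))) : Prop :=
  (valuedCongruenceSubgroup (Fin n) (1 : WithZero (Multiplicative ℤ))).map (GLn.ofLocal n K v) ≤ Kf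

variable {n K v} in
/-- The finite parts of the entries of `GLn.ofLocal g` are integral as soon as `g` is
(at `v` they are the entries of `g`, elsewhere those of the identity matrix). [folklore] -/
theorem GLn.snd_coe_ofLocal_apply_mem {g : GL (Fin n) (v.adicCompletion K)}
    (hg : ∀ i j, Valued.v ((g : Matrix (Fin n) (Fin n) (v.adicCompletion K)) i j) ≤ 1)
    (i j : Fin n) :
    ((GLn.ofLocal n K v g : Matrix (Fin n) (Fin n) (AdeleRing (𝓞 K) K)) i j).2 ∈
      integralFiniteAdeles K := by
  intro w
  change ((1 : Matrix (Fin n) (Fin n) (AdeleRing (𝓞 K) K)) i j).2 w +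
    finiteAdeleSingleHom K v ((g : Matrix (Fin n) (Fin n) (v.adicCompletion K)) i j -
      (1 : Matrix (Fin n) (Fin n) (v.adicCompletion K)) i j) w ∈ _
  have h1 : ((1 : Matrix (Fin n) (Fin n) (AdeleRing (𝓞 K) K)) i j).2 w =
      (1 : Matrix (Fin n) (Fin n) (w.adicCompletion K)) i j :=
    adeleEval_one_apply n K w i j
  rw [HeightOneSpectrum.mem_adicCompletionIntegers, h1]
  by_cases hw : w = v
  · subst hw
    rw [finiteAdeleSingleHom_apply_self, add_sub_cancel]
    exact hg i j
  · rw [finiteAdeleSingleHom_apply_of_ne K v _ hw, add_zero, Matrix.one_apply]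
    split_ifs <;> simp

/-- The full integral level `K^max` is maximal at every finite place: it contains
`GL_n(𝒪_v) ↪ GL_n(𝔸_K)` (the archimedean part of `GLn.ofLocal g` is `1`; Bump §3.3). [folklore] -/
theorem isMaximalAt_glIntegralLevel : IsMaximalAt n K v (glIntegralLevel n K) := by
  rintro _ ⟨g, hg, rfl⟩
  rw [mem_glIntegralLevel_iff', ← map_inv]
  exact ⟨⟨GLn.snd_coe_ofLocal_apply_mem hg.1, GLn.snd_coe_ofLocal_apply_mem hg.2.1⟩,
    GLn.fst_coe_ofLocal_apply g⟩

variable {n K v} in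
/-- The `w`-components of `GLn.ofLocal g`, `g ∈ GL_n(𝒪_v)`, lie in every valued congruence
subgroup for `w ≠ v` (they are `1`) and in `GL_n(𝒪_w)` for `w = v`. [folklore] -/
theorem GLn.toLocal_ofLocal_mem_valuedCongruenceSubgroup {g : GL (Fin n) (v.adicCompletion K)}
    (hg : g ∈ valuedCongruenceSubgroup (Fin n) (1 : WithZero (Multiplicative ℤ)))
    (w : HeightOneSpectrum (𝓞 K)) {c : WithZero (Multiplicative ℤ)} (hc : w = v → c = 1) :
    (AdelicGroupData.gl n K).toLocal w (GLn.ofLocal n K v g) ∈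
      valuedCongruenceSubgroup (Fin n) c := by
  by_cases hw : w = v
  · subst hw
    rw [hc rfl, GLn.toLocal_ofLocal]
    exact hg
  · rw [GLn.toLocal_ofLocal_of_ne hw]
    exact one_mem _

/-- The principal congruence subgroup `K(𝔫)` is maximal at every `v ∤ 𝔫` (`𝔫 ≠ 0`): there
`|𝔫|_v = 1`, so the local condition at `v` is just `g_v ∈ GL_n(𝒪_v)`, and `GLn.ofLocal g` is `1`
at all other places (Bump §3.3; Borel–Jacquet (1979), §4.6). [cite: BorelJacquet1979] -/
theorem isMaximalAt_principalCongruenceLevel {𝔫 : Ideal (𝓞 K)} (h𝔫 : 𝔫 ≠ 0)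
    (hv : ¬ v.asIdeal ∣ 𝔫) : IsMaximalAt n K v (principalCongruenceLevel n K 𝔫) := by
  rintro _ ⟨g, hg, rfl⟩
  rw [mem_principalCongruenceLevel_iff]
  refine ⟨isMaximalAt_glIntegralLevel n K v ⟨g, hg, rfl⟩, fun w => ?_⟩
  refine GLn.toLocal_ofLocal_mem_valuedCongruenceSubgroup hg w fun hw => ?_
  subst hw
  exact idealRadius_eq_one_of_not_dvd h𝔫 hv

/-! ### The finite part of the level -/

/-- The embedding `GL_n(𝔸_K^∞) →* GL_n(𝔸_K) = GL_n(K_∞ × 𝔸_K^∞)`, `h ↦ (1, h)`: on matrices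
`h ↦ 1 + ι (h - 1)` for the (non-unital) factor inclusion `ι : 𝔸_K^∞ → 𝔸_K` (`oneAddHom`), then
`Units.map` (Godement–Jacquet, LNM 260, §10). [folklore] -/
def GLn.ofFinite : GL (Fin n) (FiniteAdeleRing (𝓞 K) K) →* GL (Fin n) (AdeleRing (𝓞 K) K) :=
  Units.map (oneAddHom
    (((0 : FiniteAdeleRing (𝓞 K) K →ₙ+* InfiniteAdeleRing K).prod
      (NonUnitalRingHom.id (FiniteAdeleRing (𝓞 K) K))).mapMatrix (Fin n)))

variable {n K} in
/-- Entries of `GLn.ofFinite h` are `(δ_{ij}, h_{ij})` (definitional up to `add_sub_cancel`). [folklore] -/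
theorem GLn.coe_ofFinite_apply (h : GL (Fin n) (FiniteAdeleRing (𝓞 K) K)) (i j : Fin n) :
    (GLn.ofFinite n K h : Matrix (Fin n) (Fin n) (AdeleRing (𝓞 K) K)) i j =
      ((1 : Matrix (Fin n) (Fin n) (InfiniteAdeleRing K)) i j,
        (h : Matrix (Fin n) (Fin n) (FiniteAdeleRing (𝓞 K) K)) i j) := by
  refine Prod.ext ?_ ?_
  · change ((1 : Matrix (Fin n) (Fin n) (AdeleRing (𝓞 K) K)) i j).1 + 0 = _
    rw [add_zero, Matrix.one_apply, Matrix.one_apply]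
    split_ifs <;> rfl
  · change ((1 : Matrix (Fin n) (Fin n) (AdeleRing (𝓞 K) K)) i j).2 +
      ((h : Matrix (Fin n) (Fin n) (FiniteAdeleRing (𝓞 K) K)) i j -
        (1 : Matrix (Fin n) (Fin n) (FiniteAdeleRing (𝓞 K) K)) i j) = _
    rw [Matrix.one_apply, Matrix.one_apply]
    split_ifs
    · change (1 : FiniteAdeleRing (𝓞 K) K) + _ = _
      rw [add_sub_cancel]
    · change (0 : FiniteAdeleRing (𝓞 K) K) + _ = _
      rw [zero_add, sub_zero]

variable {n K} in
/-- `GLn.ofFinite` is a section of the projection to the finite part. [folklore] -/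
@[simp]
theorem GLn.sndHom_ofFinite (h : GL (Fin n) (FiniteAdeleRing (𝓞 K) K)) :
    GLn.sndHom n K (GLn.ofFinite n K h) = h :=
  Matrix.GeneralLinearGroup.ext fun i j => by
    change ((GLn.ofFinite n K h : Matrix (Fin n) (Fin n) (AdeleRing (𝓞 K) K)) i j).2 = _
    rw [GLn.coe_ofFinite_apply]

variable {n K} in
/-- The archimedean part of `GLn.ofFinite h` is `1`. [folklore] -/
@[simp]
theorem GLn.fstHom_ofFinite (h : GL (Fin n) (FiniteAdeleRing (𝓞 K) K)) :
    GLn.fstHom n K (GLn.ofFinite n K h) = 1 :=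
  Matrix.GeneralLinearGroup.ext fun i j => by
    change ((GLn.ofFinite n K h : Matrix (Fin n) (Fin n) (AdeleRing (𝓞 K) K)) i j).1 = _
    rw [GLn.coe_ofFinite_apply, Units.val_one]

variable {n K} in
/-- `GLn.ofFinite` maps `GL_n(𝒪̂_K)` into the level `K^max = {1} × GL_n(𝒪̂_K)`. [folklore] -/
theorem GLn.ofFinite_mem_glIntegralLevel {h : GL (Fin n) (FiniteAdeleRing (𝓞 K) K)}
    (hh : h ∈ glFiniteIntegralLevel n K) : GLn.ofFinite n K h ∈ glIntegralLevel n K := by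
  rw [mem_glIntegralLevel_iff, GLn.sndHom_ofFinite, GLn.fstHom_ofFinite]
  exact ⟨hh, rfl⟩

/-- The projection of the level `K^max ≤ GL_n(𝔸_K)` to `GL_n(𝔸_K^∞)` is exactly `GL_n(𝒪̂_K)`
(Godement–Jacquet, LNM 260, §10). [folklore] -/
theorem map_sndHom_glIntegralLevel :
    (glIntegralLevel n K).map (GLn.sndHom n K) = glFiniteIntegralLevel n K := by
  refine le_antisymm (Subgroup.map_le_iff_le_comap.mpr inf_le_left) fun h hh => ?_
  exact ⟨GLn.ofFinite n K h, GLn.ofFinite_mem_glIntegralLevel hh, GLn.sndHom_ofFinite h⟩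

/-- **Openness of the level** (the honest form of the outline's `isOpen_glIntegralLevel`): the
projection of `K^max` to `GL_n(𝔸_K^∞)` is the open subgroup `GL_n(𝒪̂_K)`. (`K^max` itself is
compact but not open in `GL_n(𝔸_K)`, which has no compact open subgroups;
Godement–Jacquet, LNM 260, §10.) [folklore] -/
theorem isOpen_map_sndHom_glIntegralLevel :
    IsOpen ((glIntegralLevel n K).map (GLn.sndHom n K) :
      Set (GL (Fin n) (FiniteAdeleRing (𝓞 K) K))) := by
  rw [map_sndHom_glIntegralLevel]
  exact isOpen_glFiniteIntegralLevel n K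

/-! ### Adelic Hecke operators at a finite place -/

open scoped Classical in
/-- The **local idele** map `K_vˣ →* (𝔸_K^∞)ˣ`, `ϖ ↦ (ϖ at v, 1 elsewhere)` (`Units.map` of
Mathlib's `RestrictedProduct.mulSingle`); applied to a uniformizer `ϖ_v` it is the idele whose
Hecke double cosets give `T_{v,i}` (Cassels–Fröhlich, Ch. II §16; Bump §3.3). Compare
`Literature.NumberTheory.GaloisRepresentations.localUnits` of trunk G09 (valued in `𝔸_Kˣ`; not imported here to keep the dependency
graph of G19 short, review F10). [folklore] -/
def uniformizerIdele : (v.adicCompletion K)ˣ →* (FiniteAdeleRing (𝓞 K) K)ˣ :=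
  Units.map
    { toFun := fun x => (RestrictedProduct.mulSingle
        (fun w : HeightOneSpectrum (𝓞 K) => w.adicCompletionIntegers K) v x :
          Πʳ w : HeightOneSpectrum (𝓞 K), [w.adicCompletion K, w.adicCompletionIntegers K])
      map_one' := RestrictedProduct.mulSingle_one _ _
      map_mul' := RestrictedProduct.mulSingle_mul _ _ }

/-- `uniformizerIdele K v ϖ` has component `ϖ` at `v`. [folklore] -/
@[simp]
theorem uniformizerIdele_apply_self (ϖ : (v.adicCompletion K)ˣ) :
    (uniformizerIdele K v ϖ : FiniteAdeleRing (𝓞 K) K) v = ϖ := by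
  classical
  exact RestrictedProduct.mulSingle_eq_same _ v _

/-- `uniformizerIdele K v ϖ` has component `1` away from `v`. [folklore] -/
theorem uniformizerIdele_apply_of_ne {w : HeightOneSpectrum (𝓞 K)} (ϖ : (v.adicCompletion K)ˣ)
    (h : w ≠ v) : (uniformizerIdele K v ϖ : FiniteAdeleRing (𝓞 K) K) w = 1 := by
  classical
  exact RestrictedProduct.mulSingle_eq_of_ne _ _ h

/-- Diagonal invertible matrices: `(Fin n → Rˣ) →* GL_n(R)` (Mathlib `Matrix.diagonalRingHom`,
`Units.map`, `MulEquiv.piUnits`; Mathlib has no bundled `GeneralLinearGroup.diagonal`). [folklore] -/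
def glDiagonal (R : Type*) [CommRing R] : (Fin n → Rˣ) →* GL (Fin n) R :=
  (Units.map (Matrix.diagonalRingHom (Fin n) R).toMonoidHom).comp
    (MulEquiv.piUnits (M := fun _ : Fin n => R)).symm.toMonoidHom

/-- The underlying matrix of `glDiagonal d` is `diagonal (fun k ↦ d k)`. [folklore] -/
@[simp]
theorem coe_glDiagonal (R : Type*) [CommRing R] (d : Fin n → Rˣ) :
    (glDiagonal n R d : Matrix (Fin n) (Fin n) R) = Matrix.diagonal fun k => (d k : R) := rfl

/-- The **Hecke element** `t_{v,i} = diag(ϖ_v, …, ϖ_v, 1, …, 1) ∈ GL_n(𝔸_K)` (`i` copies of the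
local idele of `ϖ` in the first `i` diagonal slots; identity at infinity and at all `w ≠ v`).
Its `K^max`-double coset defines the Hecke operator `T_{v,i}`; for `i > n` it equals `t_{v,n}`
(Bump §3.3; Borel–Jacquet (1979), §4.6; Godement–Jacquet, LNM 260, §10). [cite: BorelJacquet1979] -/
def heckeDiagAt (ϖ : (v.adicCompletion K)ˣ) (i : ℕ) : GL (Fin n) (AdeleRing (𝓞 K) K) :=
  glDiagonal n (AdeleRing (𝓞 K) K) fun k =>
    if k.val < i then
      Units.map (MonoidHom.inr (InfiniteAdeleRing K) (FiniteAdeleRing (𝓞 K) K) :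
        FiniteAdeleRing (𝓞 K) K →* AdeleRing (𝓞 K) K) (uniformizerIdele K v ϖ)
    else 1

/-- `t_{v,0} = 1`. [folklore] -/
@[simp]
theorem heckeDiagAt_zero (ϖ : (v.adicCompletion K)ˣ) : heckeDiagAt n K v ϖ 0 = 1 := by
  refine Matrix.GeneralLinearGroup.ext fun i j => ?_
  simp [heckeDiagAt]

end Local

/-! ### Hecke operators, Satake parameters and local components on `L²` -/

section Spectrum

variable {n : ℕ} {K : Type} [Field K] [NumberField K]
  {μ : Measure (AdelicGroupData.gl n K).automorphicQuotient}
  [SMulInvariantMeasure (AdelicGroupData.gl n K).Adelic (AdelicGroupData.gl n K).automorphicQuotient μ]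

/-- The **Hecke operator `T_{v,i}`** on a closed subrepresentation `W ≤ L²(GL_n(K) A_G \\ GL_n(𝔸_K))`
at full level `K^max = {1} × GL_n(𝒪̂_K)`: the double-coset operator `[K^max t_{v,i} K^max]`
(`heckeOperatorAt` of `AutomorphicSpectrum` with `heckeDiagAt`). By outline D10 the quotient is
by `A_G · GL_n(K)`, on which `t_{v,i}` acts through `rightRegular` (Bump §3.3;
Borel–Jacquet (1979), §4.6). [cite: BorelJacquet1979] -/
def heckeTAt (W : ContRepresentation.ClosedSubrep ((AdelicGroupData.gl n K).rightRegular μ))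
    (v : HeightOneSpectrum (𝓞 K)) (ϖ : (v.adicCompletion K)ˣ) (i : ℕ) :
    Module.End ℂ W.toSubmodule :=
  heckeOperatorAt W (glIntegralLevel n K) (heckeDiagAt n K v ϖ i)

/-- `W` **has Satake parameter `α` at `v`** (a multiset of `n` complex numbers) with respect to
the level `Kf` and the uniformizer `ϖ`: `ϖ` is a uniformizer of `K_v` (`|ϖ|_v = exp (-1)`),
`card α = n`, and there is a non-zero `Kf`-fixed vector `f ∈ W` with
`[Kf t_{v,i} Kf] f = q_v^{i(n-i)/2} e_i(α) • f` for `0 ≤ i ≤ n`, where `q_v = v.residueCard`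
(imported from `Literature.Prelude.GalRep.IntegralGaloisAction`) and `e_i` is Mathlib's
`Multiset.esymm` (Satake/Tamagawa: the eigenvalue of `T_{v,i}` on the spherical vector of the
unramified representation with Satake parameter `α`; Bump §3.3 for `n = 2`; Borel–Jacquet
(1979), §4.6; Gross, *On the Satake isomorphism*, (3.14)). Meaningful for `Kf` compact with open
finite part and maximal at `v` (`IsMaximalAt`), e.g. `Kf = principalCongruenceLevel n K 𝔫` with
`v ∤ 𝔫`; with `Kf = glIntegralLevel n K` it forces `W` to be unramified everywhere. Convention:
`t_{v,i} = diag(ϖ,…,ϖ,1,…,1)` acting through `rightRegular g f = f (g⁻¹ • ·)`. [folklore] -/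
def HasSatakeParameterAt
    (W : ContRepresentation.ClosedSubrep ((AdelicGroupData.gl n K).rightRegular μ))
    (Kf : Subgroup (GL (Fin n) (AdeleRing (𝓞 K) K))) (v : HeightOneSpectrum (𝓞 K))
    (ϖ : (v.adicCompletion K)ˣ) (α : Multiset ℂ) : Prop :=
  Valued.v (ϖ : v.adicCompletion K) = WithZero.exp (-1 : ℤ) ∧ Multiset.card α = n ∧
    ∃ f ∈ W.fixedVectors Kf, f ≠ 0 ∧ ∀ i ≤ n,
      heckeOperatorAt W Kf (heckeDiagAt n K v ϖ i) f =
        (((Real.sqrt (v.residueCard : ℝ) : ℝ) : ℂ) ^ (i * (n - i)) * α.esymm i) • f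

/-- `W` is **unramified at `v`**: for some non-zero level `𝔫 ⊆ 𝓞 K` prime to `v` (so that the
principal congruence subgroup `K(𝔫)` is `GL_n(𝒪_v)` at `v`, `isMaximalAt_principalCongruenceLevel`)
`W` has a Satake parameter at `v` with respect to `K(𝔫)` and some uniformizer
(Borel–Jacquet (1979), §4.6; Bump §3.3–3.4). This refines the outline's
`∃ ϖ α, HasSatakeParameterAt W (glIntegralLevel n K) v ϖ α` ("unramified everywhere"), which
implies it (`IsUnramifiedAt.of_glIntegralLevel`); see the module docstring (flagged for the
architect). [cite: BorelJacquet1979] -/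
def IsUnramifiedAt (W : ContRepresentation.ClosedSubrep ((AdelicGroupData.gl n K).rightRegular μ))
    (v : HeightOneSpectrum (𝓞 K)) : Prop :=
  ∃ 𝔫 : Ideal (𝓞 K), 𝔫 ≠ 0 ∧ ¬ v.asIdeal ∣ 𝔫 ∧ ∃ (ϖ : (v.adicCompletion K)ˣ) (α : Multiset ℂ),
    HasSatakeParameterAt W (principalCongruenceLevel n K 𝔫) v ϖ α

/-- A Satake parameter has `n` entries (definitional). [folklore] -/
theorem HasSatakeParameterAt.card_eq
    {W : ContRepresentation.ClosedSubrep ((AdelicGroupData.gl n K).rightRegular μ)}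
    {Kf : Subgroup (GL (Fin n) (AdeleRing (𝓞 K) K))} {v : HeightOneSpectrum (𝓞 K)}
    {ϖ : (v.adicCompletion K)ˣ} {α : Multiset ℂ} (h : HasSatakeParameterAt W Kf v ϖ α) :
    Multiset.card α = n :=
  h.2.1

/-- A Satake parameter at full level `K^max = K(1)` makes `W` unramified at `v` (take `𝔫 = 𝓞 K`;
`principalCongruenceLevel_top`; Borel–Jacquet (1979), §4.6). [cite: BorelJacquet1979] -/
theorem IsUnramifiedAt.of_glIntegralLevel
    {W : ContRepresentation.ClosedSubrep ((AdelicGroupData.gl n K).rightRegular μ)}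
    {v : HeightOneSpectrum (𝓞 K)} {ϖ : (v.adicCompletion K)ˣ} {α : Multiset ℂ}
    (h : HasSatakeParameterAt W (glIntegralLevel n K) v ϖ α) : IsUnramifiedAt W v := by
  refine ⟨⊤, ?_, fun hv => v.isPrime.ne_top (Ideal.eq_top_of_isUnit_mem _ ?_ isUnit_one), ϖ, α, ?_⟩
  · exact top_ne_bot
  · exact Ideal.le_of_dvd hv trivial
  · rwa [principalCongruenceLevel_top]

/-- An unramified `W` has a non-zero vector fixed by a principal congruence subgroup `K(𝔫)`
of level prime to `v` (Borel–Jacquet (1979), §4.6). [cite: BorelJacquet1979] -/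
theorem IsUnramifiedAt.exists_mem_fixedVectors
    {W : ContRepresentation.ClosedSubrep ((AdelicGroupData.gl n K).rightRegular μ)}
    {v : HeightOneSpectrum (𝓞 K)} (h : IsUnramifiedAt W v) :
    ∃ 𝔫 : Ideal (𝓞 K), 𝔫 ≠ 0 ∧ ¬ v.asIdeal ∣ 𝔫 ∧
      ∃ f ∈ W.fixedVectors (principalCongruenceLevel n K 𝔫), f ≠ 0 := by
  obtain ⟨𝔫, h𝔫, hv, _, _, _, _, f, hf, hf0, _⟩ := h
  exact ⟨𝔫, h𝔫, hv, f, hf, hf0⟩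

/-- `W` **has local component `ρ` at `v`**, for a representation `ρ` of `GL_n(K_v)`: there is a
non-zero `ℂ`-linear map `V_ρ → W` intertwining `ρ` with the restriction of `W` to `GL_n(K_v)`
along the local embedding `GLn.ofLocal` (Flath's factorisation `Π ≅ ⊗' Π_v`;
Borel–Jacquet (1979), §4.6; Bump §3.3–3.4). Meaningful for `ρ` irreducible (smooth
admissible): for reducible `ρ` a non-zero intertwiner may exist for trivial reasons (through a
quotient of `ρ` occurring in `W`), as for C7's `IsSatakeParameter`. [cite: BorelJacquet1979] -/
def HasLocalComponentAt
    (W : ContRepresentation.ClosedSubrep ((AdelicGroupData.gl n K).rightRegular μ))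
    (v : HeightOneSpectrum (𝓞 K)) {V : Type*} [AddCommGroup V] [Module ℂ V]
    (ρ : Representation ℂ (GL (Fin n) (v.adicCompletion K)) V) : Prop :=
  ∃ f : V →ₗ[ℂ] W.toSubmodule, f ≠ 0 ∧
    ∀ (g : GL (Fin n) (v.adicCompletion K)) (x : V),
      f (ρ g x) = W.toContRep (GLn.ofLocal n K v g) (f x)

end Spectrum

end Literature.NumberTheory.Automorphic
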